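import Summits.QuantumAdvantage.QuantumAdvantage.Theorems.CubicForrelationNearExactIsExactCubicFormCellL2
import Summits.QuantumAdvantage.QuantumAdvantage.Theorems.CubicForrelationNearExactIsExactCubicFormLightStructure
import Mathlib.Tactic.IntervalCases

/-!
# Crux `CubicForrelation.NearExactIsExact` (stmt-QuantumAdvantage-14043) — E1280-even, R2 branch, descendant `s₀ω₄`: the EXACT neighbour
  (`μ = 2`, weight `< 128`)

Certificate seat `b2b-cforr-cert` (gen 42).  HONEST FRAMING: kernel-checked cell lemmas (standard axioms) for the last open R2 endgame `H2`
(…CubicFormR2LowAssembly): for a cell `f` on `1 + 8` bits with cubic form `s₀ ∧ ω₄` and FEWER THAN `128` ones, one of the two halves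
`f(0,·)`, `f(1,·)` has vanishing symplectic form (both halves of rank `≥ 1` would weigh `≥ 64 + 64`, `tcl_halves_rank` + Dickson); hence the
mixed slice `G|_{H×H}` between the light cell and such a neighbour is a pure multiple of `ω₄` (the `D = 0` case of R2-PARTNER §4(ω₄)(a)).
Nothing about `θ₁₂`; NOT summit progress.

* `tpw_cell_eight_mu2_lt128`: the cell lemma; * `tpw_light_structure_mu2_lt128`: the light structure (as `tls_light_structure`, for `h = 2`).
-/

set_option linter.dupNamespace false -- D-0017: single-problem summit ⇒ `QuantumAdvantage.QuantumAdvantage` by design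

namespace Summit.QuantumAdvantage.QuantumAdvantage.Theorems.CubicForrelation.NearExactIsExact

open Finset
open Literature.Computability.QuantumComplexity
open Literature.Computability.QuantumComplexity.BuzetChailloux (bxor zeroVec bxor_comm bxor_self bxor_zeroVec zeroVec_bxor
  bxor_bxor_cancel_left)

/-- **Cell lemma L2, `μ = 2`, exact case.**  A cell on `1 + 8` bits with cubic form `s₀ ∧ ω₄` and fewer than `128` ones has a half with
vanishing form. [this work; cite: MacWilliamsSloane1977, Ch. 15 §2] -/
theorem tpw_cell_eight_mu2_lt128 (f : (Fin (1 + 8) → Bool) → Bool) (lo hi : Fin 2 → Fin 8)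
    (hlo : Function.Injective lo) (hhi : Function.Injective hi) (hlohi : ∀ i j, lo i ≠ hi j)
    (ω' : (Fin 8 → Bool) → (Fin 8 → Bool) → Bool)
    (hω' : ∀ v w, ω' v w = decide ((∑ i : Fin 2, ((if v (lo i) = true then (1 : ZMod 2) else 0) * (if w (hi i) = true then (1 : ZMod 2) else 0) +
        (if v (hi i) = true then (1 : ZMod 2) else 0) * (if w (lo i) = true then (1 : ZMod 2) else 0))) = 1))
    (hT : ∀ u v w x : Fin (1 + 8) → Bool,
      (((f x ^^ f (bxor x w)) ^^ (f (bxor x v) ^^ f (bxor (bxor x v) w))) ^^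
          ((f (bxor x u) ^^ f (bxor (bxor x u) w)) ^^ (f (bxor (bxor x u) v) ^^ f (bxor (bxor (bxor x u) v) w)))) =
        (((u (Fin.castAdd 8 (0 : Fin 1)) && ω' (fun j => v (Fin.natAdd 1 j)) (fun j => w (Fin.natAdd 1 j))) ^^
            (v (Fin.castAdd 8 (0 : Fin 1)) && ω' (fun j => u (Fin.natAdd 1 j)) (fun j => w (Fin.natAdd 1 j)))) ^^
          (w (Fin.castAdd 8 (0 : Fin 1)) && ω' (fun j => u (Fin.natAdd 1 j)) (fun j => v (Fin.natAdd 1 j)))))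
    (hlt : #(univ.filter fun y : Fin (1 + 8) → Bool => f y = true) < 128) :
    let f₀ : (Fin 8 → Bool) → Bool := fun s => f (Fin.append ![false] s)
    let f₁ : (Fin 8 → Bool) → Bool := fun s => f (Fin.append ![true] s)
    (∀ v w x, ((f₀ x ^^ f₀ (bxor x w)) ^^ (f₀ (bxor x v) ^^ f₀ (bxor (bxor x v) w))) = false) ∨
    (∀ v w x, ((f₁ x ^^ f₁ (bxor x w)) ^^ (f₁ (bxor x v) ^^ f₁ (bxor (bxor x v) w))) = false) := by
  intro f₀ f₁
  obtain ⟨h3, hforms⟩ := tl2_cell_halves f ω' hT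
  have h30 := h3 false
  have h31 := h3 true
  simp only at h30 h31
  obtain ⟨B₀, hB₀⟩ : ∃ B₀ : (Fin 8 → Bool) → (Fin 8 → Bool) → Bool,
      ∀ v w, B₀ v w = ((f₀ zeroVec ^^ f₀ (bxor zeroVec w)) ^^ (f₀ (bxor zeroVec v) ^^ f₀ (bxor (bxor zeroVec v) w))) :=
    ⟨_, fun v w => rfl⟩
  obtain ⟨B₁, hB₁⟩ : ∃ B₁ : (Fin 8 → Bool) → (Fin 8 → Bool) → Bool,
      ∀ v w, B₁ v w = ((f₁ zeroVec ^^ f₁ (bxor zeroVec w)) ^^ (f₁ (bxor zeroVec v) ^^ f₁ (bxor (bxor zeroVec v) w))) :=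
    ⟨_, fun v w => rfl⟩
  have hB₀' : ∀ v w x, ((f₀ x ^^ f₀ (bxor x w)) ^^ (f₀ (bxor x v) ^^ f₀ (bxor (bxor x v) w))) = B₀ v w :=
    fun v w x => by rw [hB₀]; exact tl2_second_const f₀ h30 v w x
  have hB₁' : ∀ v w x, ((f₁ x ^^ f₁ (bxor x w)) ^^ (f₁ (bxor x v) ^^ f₁ (bxor (bxor x v) w))) = B₁ v w :=
    fun v w x => by rw [hB₁]; exact tl2_second_const f₁ h31 v w x
  have hω : ∀ v w, (B₀ v w ^^ B₁ v w) = ω' v w := fun v w => by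
    rw [← hB₀' v w zeroVec, ← hB₁' v w zeroVec]; exact hforms v w zeroVec zeroVec
  obtain ⟨o1, o2, o3, o4, omax⟩ := tl2_omega_frame 2 lo hi hlo hhi hlohi ω' hω'
  have hcard : #(univ.filter fun x : Fin 8 → Bool => f₀ x = true) + #(univ.filter fun x : Fin 8 → Bool => f₁ x = true) < 128 := by
    rw [← tco_card_halves]; exact hlt
  obtain ⟨h₀, h₁, b₀, c₀, b₁, c₁, hfr₀, hfr₁, hsum, h2h₀, h2h₁, hD₀, hD₁⟩ :=
    tcl_halves_rank f₀ f₁ B₀ B₁ hB₀' hB₁' 2 (fun i => fun l => decide (l = lo i)) (fun i => fun l => decide (l = hi i))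
      (fun i => by rw [hω]; exact o1 i) (fun i j hij => by rw [hω]; exact o2 i j hij) (fun i j => by rw [hω]; exact o3 i j)
      (fun x y h1 h2 h3' h4 => by
        rw [hω]
        exact omax x y (fun i => by rw [← hω]; exact h1 i) (fun i => by rw [← hω]; exact h2 i) (fun i => by rw [← hω]; exact h3' i)
          (fun i => by rw [← hω]; exact h4 i))
  by_cases hz0 : h₀ = 0
  · subst hz0
    left
    intro v w x
    rw [hB₀']
    exact hfr₀.2.2.2.2 v w (fun i => i.elim0) (fun i => i.elim0) (fun i => i.elim0) (fun i => i.elim0)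
  · by_cases hz1 : h₁ = 0
    · subst hz1
      right
      intro v w x
      rw [hB₁']
      exact hfr₁.2.2.2.2 v w (fun i => i.elim0) (fun i => i.elim0) (fun i => i.elim0) (fun i => i.elim0)
    · exfalso
      have hh₀ : h₀ ≤ 4 := by omega
      have hh₁ : h₁ ≤ 4 := by omega
      have hp₀ : 1 ≤ h₀ := Nat.pos_of_ne_zero hz0
      have hp₁ : 1 ≤ h₁ := Nat.pos_of_ne_zero hz1
      interval_cases h₀ <;> interval_cases h₁ <;> simp only [Nat.reducePow, Nat.reduceSub] at hD₀ hD₁ <;> omega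

/-- **Light structure for an EXACT `ω₄`-neighbour.**  `κ` cubic on `3 + (1 + 8)` bits, light cell `ρ₀ = κ(v₀,·)` with cubic form `s₀ ∧ ω₄`
vanishing on the half `s₀ = ¬b`, neighbour `κ(v₀ ⊕ e_t, ·)` with FEWER THAN `128` ones: the mixed slice on `H × H` is `ε · ω₄`.
(`tls_light_structure` with `h = 2`, the cell lemma replaced by `tpw_cell_eight_mu2_lt128`.) [this work] -/
theorem tpw_light_structure_mu2_lt128 (κ : (Fin (3 + (1 + 8)) → Bool) → Bool) (hκ : IsDegLeFun 3 κ) (v₀ : Fin 3 → Bool)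
    (lo hi : Fin 2 → Fin 8)
    (hlo : Function.Injective lo) (hhi : Function.Injective hi) (hlohi : ∀ i j, lo i ≠ hi j)
    (ω' : (Fin 8 → Bool) → (Fin 8 → Bool) → Bool)
    (hω' : ∀ v w, ω' v w = decide ((∑ i : Fin 2, ((if v (lo i) = true then (1 : ZMod 2) else 0) * (if w (hi i) = true then (1 : ZMod 2) else 0) +
        (if v (hi i) = true then (1 : ZMod 2) else 0) * (if w (lo i) = true then (1 : ZMod 2) else 0))) = 1))
    (hT : ∀ u v w x : Fin (1 + 8) → Bool,
      ((((fun s => κ (Fin.append v₀ s)) x ^^ (fun s => κ (Fin.append v₀ s)) (bxor x w)) ^^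
          ((fun s => κ (Fin.append v₀ s)) (bxor x v) ^^ (fun s => κ (Fin.append v₀ s)) (bxor (bxor x v) w))) ^^
        (((fun s => κ (Fin.append v₀ s)) (bxor x u) ^^ (fun s => κ (Fin.append v₀ s)) (bxor (bxor x u) w)) ^^
          ((fun s => κ (Fin.append v₀ s)) (bxor (bxor x u) v) ^^ (fun s => κ (Fin.append v₀ s)) (bxor (bxor (bxor x u) v) w)))) =
        (((u (Fin.castAdd 8 (0 : Fin 1)) && ω' (fun j => v (Fin.natAdd 1 j)) (fun j => w (Fin.natAdd 1 j))) ^^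
            (v (Fin.castAdd 8 (0 : Fin 1)) && ω' (fun j => u (Fin.natAdd 1 j)) (fun j => w (Fin.natAdd 1 j)))) ^^
          (w (Fin.castAdd 8 (0 : Fin 1)) && ω' (fun j => u (Fin.natAdd 1 j)) (fun j => v (Fin.natAdd 1 j)))))
    (b : Bool) (hhalf : ∀ s : Fin 8 → Bool, κ (Fin.append v₀ (Fin.append ![!b] s)) = false)
    (t : Fin 3) (hwt : #(univ.filter fun y : Fin (1 + 8) → Bool => κ (Fin.append (bxor v₀ (fun l => decide (l = t))) y) = true) < 128) :
    ∃ ε : Bool, ∀ σ τ : Fin 8,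
      (((κ (Fin.append v₀ zeroVec) ^^ κ (bxor (Fin.append v₀ zeroVec) (fun l => decide (l = Fin.natAdd 3 (Fin.natAdd 1 τ))))) ^^
          (κ (bxor (Fin.append v₀ zeroVec) (fun l => decide (l = Fin.natAdd 3 (Fin.natAdd 1 σ)))) ^^
            κ (bxor (bxor (Fin.append v₀ zeroVec) (fun l => decide (l = Fin.natAdd 3 (Fin.natAdd 1 σ))))
              (fun l => decide (l = Fin.natAdd 3 (Fin.natAdd 1 τ)))))) ^^
        ((κ (bxor (Fin.append v₀ zeroVec) (fun l => decide (l = Fin.castAdd (1 + 8) t))) ^^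
            κ (bxor (bxor (Fin.append v₀ zeroVec) (fun l => decide (l = Fin.castAdd (1 + 8) t)))
              (fun l => decide (l = Fin.natAdd 3 (Fin.natAdd 1 τ))))) ^^
          (κ (bxor (bxor (Fin.append v₀ zeroVec) (fun l => decide (l = Fin.castAdd (1 + 8) t)))
              (fun l => decide (l = Fin.natAdd 3 (Fin.natAdd 1 σ)))) ^^
            κ (bxor (bxor (bxor (Fin.append v₀ zeroVec) (fun l => decide (l = Fin.castAdd (1 + 8) t)))
              (fun l => decide (l = Fin.natAdd 3 (Fin.natAdd 1 σ)))) (fun l => decide (l = Fin.natAdd 3 (Fin.natAdd 1 τ))))))) =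
      (ε && ω' (fun l => decide (l = σ)) (fun l => decide (l = τ))) := by
  classical
  set v₁ : Fin 3 → Bool := bxor v₀ (fun l => decide (l = t)) with hv₁
  have hT₁ : ∀ u v w x : Fin (1 + 8) → Bool,
      ((((fun s => κ (Fin.append v₁ s)) x ^^ (fun s => κ (Fin.append v₁ s)) (bxor x w)) ^^
          ((fun s => κ (Fin.append v₁ s)) (bxor x v) ^^ (fun s => κ (Fin.append v₁ s)) (bxor (bxor x v) w))) ^^
        (((fun s => κ (Fin.append v₁ s)) (bxor x u) ^^ (fun s => κ (Fin.append v₁ s)) (bxor (bxor x u) w)) ^^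
          ((fun s => κ (Fin.append v₁ s)) (bxor (bxor x u) v) ^^ (fun s => κ (Fin.append v₁ s)) (bxor (bxor (bxor x u) v) w)))) =
        (((u (Fin.castAdd 8 (0 : Fin 1)) && ω' (fun j => v (Fin.natAdd 1 j)) (fun j => w (Fin.natAdd 1 j))) ^^
            (v (Fin.castAdd 8 (0 : Fin 1)) && ω' (fun j => u (Fin.natAdd 1 j)) (fun j => w (Fin.natAdd 1 j)))) ^^
          (w (Fin.castAdd 8 (0 : Fin 1)) && ω' (fun j => u (Fin.natAdd 1 j)) (fun j => v (Fin.natAdd 1 j)))) := by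
    intro u v w x
    rw [← hT u v w x]
    exact tls_cells_third κ hκ v₁ v₀ u v w x x
  obtain ⟨h3₁, hforms₁⟩ := tl2_cell_halves (fun s => κ (Fin.append v₁ s)) ω' hT₁
  obtain ⟨h3₀, hforms₀⟩ := tl2_cell_halves (fun s => κ (Fin.append v₀ s)) ω' hT
  have h8 := tpw_cell_eight_mu2_lt128 (fun s => κ (Fin.append v₁ s)) lo hi hlo hhi hlohi ω' hω' hT₁ hwt
  simp only at h8 hforms₁ hforms₀
  have key₁ : ∃ ε₁ : Bool, ∀ σ τ : Fin 8,
      ((κ (Fin.append v₁ (Fin.append ![false] zeroVec)) ^^ κ (Fin.append v₁ (Fin.append ![false] (bxor zeroVec (fun l => decide (l = τ)))))) ^^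
        (κ (Fin.append v₁ (Fin.append ![false] (bxor zeroVec (fun l => decide (l = σ))))) ^^
          κ (Fin.append v₁ (Fin.append ![false] (bxor (bxor zeroVec (fun l => decide (l = σ))) (fun l => decide (l = τ))))))) =
      (ε₁ && ω' (fun l => decide (l = σ)) (fun l => decide (l = τ))) := by
    rcases h8 with h0 | h1
    · refine ⟨false, fun σ τ => ?_⟩
      rw [Bool.false_and]; exact h0 _ _ zeroVec
    · refine ⟨true, fun σ τ => ?_⟩
      rw [Bool.true_and, ← hforms₁ (fun l => decide (l = σ)) (fun l => decide (l = τ)) zeroVec zeroVec, h1 _ _ zeroVec, Bool.xor_false]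
  have key₀ : ∃ ε₀ : Bool, ∀ σ τ : Fin 8,
      ((κ (Fin.append v₀ (Fin.append ![false] zeroVec)) ^^ κ (Fin.append v₀ (Fin.append ![false] (bxor zeroVec (fun l => decide (l = τ)))))) ^^
        (κ (Fin.append v₀ (Fin.append ![false] (bxor zeroVec (fun l => decide (l = σ))))) ^^
          κ (Fin.append v₀ (Fin.append ![false] (bxor (bxor zeroVec (fun l => decide (l = σ))) (fun l => decide (l = τ))))))) =
      (ε₀ && ω' (fun l => decide (l = σ)) (fun l => decide (l = τ))) := by
    cases b
    · refine ⟨true, fun σ τ => ?_⟩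
      have e := hforms₀ (fun l => decide (l = σ)) (fun l => decide (l = τ)) zeroVec zeroVec
      simp only [Bool.not_false] at hhalf
      simp only [hhalf, Bool.xor_false] at e
      rw [Bool.true_and]; exact e
    · refine ⟨false, fun σ τ => ?_⟩
      simp only [Bool.not_true] at hhalf
      simp only [hhalf, Bool.false_and, Bool.xor_false]
  obtain ⟨ε₁, hε₁⟩ := key₁
  obtain ⟨ε₀, hε₀⟩ := key₀
  refine ⟨ε₁ ^^ ε₀, fun σ τ => ?_⟩
  have e := tcm_mixed_third κ v₀ t σ τ
  simp only at e
  rw [e, ← hv₁, hε₁ σ τ, hε₀ σ τ]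
  cases ε₁ <;> cases ε₀ <;> cases ω' (fun l => decide (l = σ)) (fun l => decide (l = τ)) <;> rfl

end Summit.QuantumAdvantage.QuantumAdvantage.Theorems.CubicForrelation.NearExactIsExact
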